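import Mathlib
import Summits.ValiantsHypothesis.ValiantsHypothesis.Theorems.DivisionGapShadowBirkhoffPolytropeDefs

/-!
# The domino polytope is a coordinate image of a pattern face of `DS_n` (support of `DivisionGap.ShadowBirkhoff`)

Support file for item `stmt-ValiantsHypothesis-5069` (route `DivisionGap`, crux `ShadowBirkhoff`, line
`polytrope-kr-planar-dimers`): the stub `stub_dominoFace` of the line's skeleton, over the objects of
`Theorems/DivisionGapShadowBirkhoffPolytropeDefs.lean` (`patternPoints`, `patternShadowVertexCount`,
`IsGridAdjacent`, `dominoPoints`, `dominoShadowVertexCount`).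

Statement: for `n ≥ 2m²` and every linear `L` on `ℝ^{V × V}`, `V = Fin 2m × Fin 2m`, there are a pattern
`Z ⊆ [n]²` and a linear `L'` on `ℝ^{[n]²}` with `dominoShadowVertexCount L ≤ patternShadowVertexCount Z L'`.

Construction (elementary bookkeeping; only Mathlib is used, no definitions are introduced).  Cells `(i, j)`
are black iff `i + j` is even; the board is cut into the horizontal bricks `{(2k, j), (2k+1, j)}`, indexed by
`(j, k) ∈ Fin 2m × Fin m`, each containing exactly one black and one white cell (`board_bricks`).  Bricks are
sent into `Fin n` by `Fin.castLE ∘ finProdFinEquiv` (injective, needs `2m·m ≤ n`).  Rows of the pattern are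
"black cells", columns are "white cells": `Z = {(ι a', ι a) : white a ~ black a'} ∪ {(y, y) : y ∉ range ι}`.
The linear pull-back `T : ℝ^{[n]²} → ℝ^{V × V}` (a `LinearMap.pi` of coordinate projections) reads the entry of
a (black, white) resp. (white, black) cell pair off the matrix entry (row of the black brick, column of the white
brick) and is `0` on equal-coloured pairs.  Key fact (`exists_pattern_pullback`, stated for an abstract brick
structure): `T '' patternPoints n Z = dominoPoints k` — a permutation supported in `Z` fixes the padding indices
and matches the white cells bijectively to adjacent black cells, i.e. it is a tiling; conversely a tiling gives
a permutation of the bricks, extended to `Fin n` by the identity (`Equiv.Perm.extendDomain`).  With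
`L' = L ∘ₗ T` the two shadows coincide (`Set.image_comp`), so the two vertex counts are EQUAL.
-/

set_option linter.dupNamespace false

noncomputable section

namespace Summit.ValiantsHypothesis.ValiantsHypothesis.Theorems.DivisionGapShadowBirkhoff

/-- Grid adjacency is symmetric. -/
theorem isGridAdjacent_symm {k : ℕ} {v w : Fin k × Fin k} (h : IsGridAdjacent v w) :
    IsGridAdjacent w v := by
  unfold IsGridAdjacent at h ⊢
  simp only [Fin.ext_iff] at h ⊢
  omega

/-- Adjacent cells have different colours (`(i + j) % 2`). -/
theorem isGridAdjacent_colour {k : ℕ} {v w : Fin k × Fin k} (h : IsGridAdjacent v w) :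
    ((v.1 : ℕ) + v.2) % 2 = 0 ↔ ¬ ((w.1 : ℕ) + w.2) % 2 = 0 := by
  unfold IsGridAdjacent at h
  simp only [Fin.ext_iff] at h
  omega

/-- **Abstract transfer.**  Suppose the cells of the `k × k` board are split by a predicate `B` ("black") such
that adjacent cells have different colours, and are grouped into "bricks" `α`, each brick `a` containing
exactly one black cell `bc a` and one white cell `wc a` (`brick` recovers the brick of a cell), and the bricks
embed into `Fin n` by `ι`.  Then some pattern `Z ⊆ [n]²` and some linear pull-back `T` satisfy
`T '' patternPoints n Z = dominoPoints k`. -/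
theorem exists_pattern_pullback {k n : ℕ} {α : Type*} (B : Fin k × Fin k → Prop)
    (brick : Fin k × Fin k → α) (bc wc : α → Fin k × Fin k) (ι : α → Fin n)
    (hι : Function.Injective ι) (hbc : ∀ a, B (bc a)) (hwc : ∀ a, ¬ B (wc a))
    (hbb : ∀ a, brick (bc a) = a) (hbw : ∀ a, brick (wc a) = a)
    (hb : ∀ v, B v → bc (brick v) = v) (hw : ∀ v, ¬ B v → wc (brick v) = v)
    (hadj : ∀ v w : Fin k × Fin k, IsGridAdjacent v w → (B v ↔ ¬ B w)) :
    ∃ (Z : Set (Fin n × Fin n))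
      (T : (Fin n × Fin n → ℝ) →ₗ[ℝ] ((Fin k × Fin k) × (Fin k × Fin k) → ℝ)),
      T '' patternPoints n Z = dominoPoints k := by
  classical
  -- the pattern
  obtain ⟨Z, hZ⟩ : ∃ Z : Set (Fin n × Fin n), ∀ p, p ∈ Z ↔
      (∃ a a' : α, p = (ι a', ι a) ∧ IsGridAdjacent (wc a) (bc a')) ∨ (p.1 = p.2 ∧ p.2 ∉ Set.range ι) :=
    ⟨{p | (∃ a a' : α, p = (ι a', ι a) ∧ IsGridAdjacent (wc a) (bc a')) ∨ (p.1 = p.2 ∧ p.2 ∉ Set.range ι)},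
      fun _ => Iff.rfl⟩
  -- the pull-back
  obtain ⟨T, hT⟩ : ∃ T : (Fin n × Fin n → ℝ) →ₗ[ℝ] ((Fin k × Fin k) × (Fin k × Fin k) → ℝ), ∀ X e,
      T X e = if B e.1 ∧ ¬ B e.2 then X (ι (brick e.1), ι (brick e.2))
        else if ¬ B e.1 ∧ B e.2 then X (ι (brick e.2), ι (brick e.1)) else 0 := by
    refine ⟨LinearMap.pi fun e =>
        if B e.1 ∧ ¬ B e.2 then LinearMap.proj (R := ℝ) (φ := fun _ : Fin n × Fin n => ℝ)
            (ι (brick e.1), ι (brick e.2))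
        else if ¬ B e.1 ∧ B e.2 then LinearMap.proj (R := ℝ) (φ := fun _ : Fin n × Fin n => ℝ)
            (ι (brick e.2), ι (brick e.1)) else 0, fun X e => ?_⟩
    rw [LinearMap.pi_apply]
    split_ifs <;> rfl
  -- the pull-back of a permutation matrix is the indicator of the graph of a colour-swapping `f` as soon as
  -- the two agree through the brick indexing on the bichromatic pairs
  have key : ∀ (r : Fin n → Fin n) (f : Fin k × Fin k → Fin k × Fin k), (∀ v, B (f v) ↔ ¬ B v) →
      (∀ v w, B v → ¬ B w → (r (ι (brick w)) = ι (brick v) ↔ f v = w)) →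
      (∀ v w, ¬ B v → B w → (r (ι (brick v)) = ι (brick w) ↔ f v = w)) →
      T (fun ij => if r ij.2 = ij.1 then (1 : ℝ) else 0) = fun e => if f e.1 = e.2 then (1 : ℝ) else 0 := by
    intro r f hcol h1 h2
    funext e
    obtain ⟨v, w⟩ := e
    rw [hT]
    dsimp only
    by_cases hv : B v <;> by_cases hw' : B w
    · have hne : f v ≠ w := fun hfw => (hcol v).1 (by rw [hfw]; exact hw') hv
      rw [if_neg (fun hc => hc.2 hw'), if_neg (fun hc => hc.1 hv), if_neg hne]
    · rw [if_pos ⟨hv, hw'⟩]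
      simp only [h1 v w hv hw']
    · rw [if_neg (fun hc => hv hc.1), if_pos ⟨hv, hw'⟩]
      simp only [h2 v w hv hw']
    · have hne : f v ≠ w := fun hfw => hw' (by rw [← hfw]; exact (hcol v).2 hv)
      rw [if_neg (fun hc => hv hc.1), if_neg (fun hc => hw' hc.2), if_neg hne]
  refine ⟨Z, T, ?_⟩
  ext x
  constructor
  · rintro ⟨X, ⟨ρ, hρ, rfl⟩, rfl⟩
    -- the permutation restricted to the bricks, and its inverse
    have hs : ∀ a, ∃ a', ρ (ι a) = ι a' ∧ IsGridAdjacent (wc a) (bc a') := by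
      intro a
      rcases (hZ _).1 (hρ (ι a)) with ⟨a₀, a', hp, hadj'⟩ | ⟨-, hna⟩
      · obtain ⟨h1, h2⟩ := Prod.mk.inj hp
        obtain rfl := hι h2
        exact ⟨a', h1, hadj'⟩
      · exact absurd (Set.mem_range_self a) hna
    choose s hs hsadj using hs
    have hs' : ∀ a, ∃ a', ρ.symm (ι a) = ι a' := by
      intro a
      rcases (hZ _).1 (hρ (ρ.symm (ι a))) with ⟨a₀, a', hp, -⟩ | ⟨hfix, hna⟩
      · exact ⟨a₀, (Prod.mk.inj hp).2⟩
      · exfalso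
        apply hna
        rw [← hfix, Equiv.apply_symm_apply]
        exact Set.mem_range_self a
    choose s' hs' using hs'
    have hss' : ∀ a, s (s' a) = a := fun a =>
      hι (by rw [← hs, ← hs', Equiv.apply_symm_apply])
    have hs's : ∀ a, s' (s a) = a := fun a =>
      hι (by rw [← hs', ← hs, Equiv.symm_apply_apply])
    -- the tiling
    obtain ⟨f, hfb, hfw⟩ : ∃ f : Fin k × Fin k → Fin k × Fin k,
        (∀ v, B v → f v = wc (s' (brick v))) ∧ (∀ v, ¬ B v → f v = bc (s (brick v))) :=
      ⟨fun v => if B v then wc (s' (brick v)) else bc (s (brick v)),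
        fun v hv => if_pos hv, fun v hv => if_neg hv⟩
    have hcol : ∀ v, B (f v) ↔ ¬ B v := by
      intro v
      by_cases hv : B v
      · rw [hfb v hv]
        exact ⟨fun h0 => absurd h0 (hwc _), fun hne => absurd hv hne⟩
      · rw [hfw v hv]
        exact ⟨fun _ => hv, fun _ => hbc _⟩
    refine ⟨f, fun v => ?_, key ρ f hcol ?_ ?_⟩
    · by_cases hv : B v
      · have hfv := hfb v hv
        have hw' : ¬ B (f v) := by rw [hfv]; exact hwc _
        refine ⟨?_, fun heq => hw' (by rw [heq]; exact hv), ?_⟩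
        · rw [hfw (f v) hw', hfv, hbw, hss', hb v hv]
        · have := hsadj (s' (brick v))
          rw [hss', hb v hv] at this
          rw [hfv]
          exact isGridAdjacent_symm this
      · have hfv := hfw v hv
        have hb' : B (f v) := by rw [hfv]; exact hbc _
        refine ⟨?_, fun heq => hv (by rw [← heq]; exact hb'), ?_⟩
        · rw [hfb (f v) hb', hfv, hbb, hs's, hw v hv]
        · have := hsadj (brick v)
          rw [hw v hv] at this
          rw [hfv]
          exact this
    · intro v w hv hw'
      rw [hs, hfb v hv]
      constructor
      · intro heq
        rw [← hι heq, hs's, hw w hw']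
      · intro heq
        rw [← heq, hbw, hss']
    · intro v w hv hw'
      rw [hs, hfw v hv]
      constructor
      · intro heq
        rw [hι heq, hb w hw']
      · intro heq
        rw [← heq, hbb]
  · rintro ⟨f, hf, rfl⟩
    have hcol : ∀ v, B (f v) ↔ ¬ B v := fun v => hadj _ _ (isGridAdjacent_symm (hf v).2.2)
    have hinv : ∀ v, f (f v) = v := fun v => (hf v).1
    -- the permutation of the bricks: a brick ↦ the brick of the black partner of its white cell
    obtain ⟨σ, hσ⟩ : ∃ σ : Equiv.Perm α, ∀ a, σ a = brick (f (wc a)) := by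
      refine ⟨⟨fun a => brick (f (wc a)), fun a => brick (f (bc a)), fun a => ?_, fun a => ?_⟩,
        fun a => rfl⟩
      · show brick (f (bc (brick (f (wc a))))) = a
        rw [hb _ ((hcol _).2 (hwc a)), hinv, hbw]
      · show brick (f (wc (brick (f (bc a))))) = a
        have hw' : ¬ B (f (bc a)) := fun h0 => (hcol _).1 h0 (hbc a)
        rw [hw _ hw', hinv, hbb]
    -- extended by the identity on the padding indices
    obtain ⟨ρ, hρ, hρ'⟩ : ∃ ρ : Equiv.Perm (Fin n),
        (∀ a, ρ (ι a) = ι (σ a)) ∧ (∀ y, y ∉ Set.range ι → ρ y = y) := by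
      refine ⟨σ.extendDomain (Equiv.ofInjective _ hι), fun a => ?_,
        fun y hy => Equiv.Perm.extendDomain_apply_not_subtype _ _ hy⟩
      simpa using Equiv.Perm.extendDomain_apply_image σ (Equiv.ofInjective _ hι) a
    refine ⟨_, ⟨ρ, fun y => ?_, rfl⟩, key ρ f hcol ?_ ?_⟩
    · rw [hZ]
      by_cases hy : y ∈ Set.range ι
      · obtain ⟨a, rfl⟩ := hy
        left
        refine ⟨a, σ a, by rw [hρ], ?_⟩
        rw [hσ, hb _ ((hcol _).2 (hwc a))]
        exact (hf _).2.2
      · right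
        exact ⟨hρ' y hy, hy⟩
    · intro v w hv hw'
      rw [hρ, hσ, hw w hw']
      constructor
      · intro heq
        have hfw : f w = v := by rw [← hb (f w) ((hcol w).2 hw'), hι heq, hb v hv]
        rw [← hfw, hinv]
      · intro heq
        rw [← heq, hinv]
    · intro v w hv hw'
      rw [hρ, hσ, hw v hv]
      constructor
      · intro heq
        rw [← hb (f v) ((hcol v).2 hv), hι heq, hb w hw']
      · intro heq
        rw [heq]

/-- **The bricks of the `2m × 2m` board.**  Brick `(j, k) ∈ Fin 2m × Fin m` is `{(2k, j), (2k+1, j)}`; its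
black cell is `(2k + j % 2, j)`, its white cell `(2k + (j+1) % 2, j)`; the brick of `(i, j)` is `(j, i / 2)`;
bricks embed into `Fin n`, `n ≥ 2m·m`, by `Fin.castLE ∘ finProdFinEquiv`. -/
theorem board_bricks (m n : ℕ) (h : 2 * m * m ≤ n) :
    ∃ (brick : Fin (2 * m) × Fin (2 * m) → Fin (2 * m) × Fin m)
      (bc wc : Fin (2 * m) × Fin m → Fin (2 * m) × Fin (2 * m)) (ι : Fin (2 * m) × Fin m → Fin n),
      Function.Injective ι ∧
        (∀ a, (((bc a).1 : ℕ) + (bc a).2) % 2 = 0) ∧ (∀ a, ¬ (((wc a).1 : ℕ) + (wc a).2) % 2 = 0) ∧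
        (∀ a, brick (bc a) = a) ∧ (∀ a, brick (wc a) = a) ∧
        (∀ v, ((v.1 : ℕ) + v.2) % 2 = 0 → bc (brick v) = v) ∧
        (∀ v, ¬ ((v.1 : ℕ) + v.2) % 2 = 0 → wc (brick v) = v) := by
  refine ⟨fun v => (v.2, ⟨(v.1 : ℕ) / 2, by have := v.1.isLt; omega⟩),
    fun a => (⟨2 * (a.2 : ℕ) + (a.1 : ℕ) % 2, by have := a.2.isLt; omega⟩, a.1),
    fun a => (⟨2 * (a.2 : ℕ) + ((a.1 : ℕ) + 1) % 2, by have := a.2.isLt; omega⟩, a.1),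
    fun a => Fin.castLE h (finProdFinEquiv a),
    (Fin.castLE_injective h).comp finProdFinEquiv.injective, ?_, ?_, ?_, ?_, ?_, ?_⟩
  · intro a
    dsimp only
    omega
  · intro a
    dsimp only
    omega
  · intro a
    refine Prod.ext rfl (Fin.ext ?_)
    dsimp only
    omega
  · intro a
    refine Prod.ext rfl (Fin.ext ?_)
    dsimp only
    omega
  · intro v hv
    refine Prod.ext (Fin.ext ?_) rfl
    dsimp only
    omega
  · intro v hv
    refine Prod.ext (Fin.ext ?_) rfl
    dsimp only
    omega

/-- **`stub_dominoFace`** of the line `polytrope-kr-planar-dimers` for `DivisionGap.ShadowBirkhoff` (item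
`stmt-ValiantsHypothesis-5069`): for `n ≥ 2m²`, every planar shadow of the domino polytope of the `2m × 2m`
board is a planar shadow of a pattern face of `DS_n` — in fact with EQUAL vertex count, for the pattern `Z` and
the pull-back `T` of `exists_pattern_pullback` over the bricks of `board_bricks`, and `L' = L ∘ₗ T`. -/
theorem stub_dominoFace :
    ∀ (m n : ℕ), 2 * m * m ≤ n →
      ∀ L : ((Fin (2 * m) × Fin (2 * m)) × (Fin (2 * m) × Fin (2 * m)) → ℝ) →ₗ[ℝ] (Fin 2 → ℝ),
        ∃ (Z : Set (Fin n × Fin n)) (L' : (Fin n × Fin n → ℝ) →ₗ[ℝ] (Fin 2 → ℝ)),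
          dominoShadowVertexCount L ≤ patternShadowVertexCount Z L' := by
  intro m n h L
  obtain ⟨brick, bc, wc, ι, hι, hbc, hwc, hbb, hbw, hb, hw⟩ := board_bricks m n h
  obtain ⟨Z, T, hT⟩ := exists_pattern_pullback (fun v : Fin (2 * m) × Fin (2 * m) => ((v.1 : ℕ) + v.2) % 2 = 0)
    brick bc wc ι hι hbc hwc hbb hbw hb hw (fun _ _ hvw => isGridAdjacent_colour hvw)
  refine ⟨Z, L ∘ₗ T, le_of_eq ?_⟩
  unfold dominoShadowVertexCount patternShadowVertexCount
  rw [LinearMap.coe_comp, Set.image_comp, hT]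

end Summit.ValiantsHypothesis.ValiantsHypothesis.Theorems.DivisionGapShadowBirkhoff

end
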